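import Summits.QuantumFields.BalabanUV.T4Continuum.Spine.NE7.QLaBlockAvgTVDomain
import Summits.QuantumFields.BalabanUV.T4Continuum.Spine.NE7.QLaBlockAvgTwoLevelContraction
import Summits.QuantumFields.BalabanUV.T4Continuum.Spine.NE7.NodeSAtDatumOfRecord
import Summits.QuantumFields.BalabanUV.T4Continuum.Spine.NE7.QLaConeNeighbourhood

/-!
# Spine/NE7/QLaBlockAvgTwoLevelTVDomain — NODE S's certificates on LEVEL-FREE total-variation balls for the TWO-LEVEL printed
# prescription [Balaban1987RG1] (0.10)–(0.12) `blockAvg₂ federbushSU expMeanLogSU` on `SU(N)` and for the headline's FULL printed class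
# `D.IsPrintedAveraged` — one constant radius at every level, no anchoring, no `L^{−m}`

Cell `pub-balaban-gaps` (YM blitz Y1, track G2, seat `ne7`, generation 14); text of record
`run/shared/lean/pub/pub-balaban-gaps/ne/NE7.md` (census row R82 of this generation).  Fifty-sixth `Spine/NE7/` file; sequel of
`QLaBlockAvgTVDomain` (file 55), importing files 47 and 41 for §5; 0 sorry; [folklore] bookkeeping over generation 8's two-level one-step estimate
(`QLaBlockAvgTwoLevelContraction.tv_framed₂_le`) and file 55's generic trajectory descent (`tvDescent_of_step`).

WHAT.  §1 the two-level framed step at the configuration's OWN size — `tv(1, F₂(V)) ≤ (θ + K₂·tv(1,V))·tv(1,V)` whenever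
`tv(1,V) ≤ e·τ⋆₂`, `τ⋆₂ = min(ρ⋆₂∕e, θ(1−θ)∕(eK₂))` (generation 8's guards `2ℓρ < δ_Fed`, `12|S_d|ℓρ < δ_N`, `≤ ½` at any size `≤ ρ⋆₂`);
§2 the tv-ball `domTV₂ j = {V | tv(1,V) ≤ τ⋆₂}` (the same at every level) is mapped into itself, the sizes decay
`tv((avgⁿV)^u) ≤ e·θⁿ·tv(1,V)`, hence `BondDevBound` ∕ `HolDevBound` (e, θ = L^{1−d}) ∕ `LoopDefectBound` (e²∕2) for the two-level
prescription on `domTV₂`; §3 the HEADLINE's class: `holDevBound_of_isPrintedAveraged₂_tv` and, on the common level-free family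
`domTVPrinted := domTV ∩ domTV₂` (a tv-ball of radius `min(τ⋆, τ⋆₂)`), `holDevBound_of_isPrintedAveraged_tv` ∕
`loopDefectBound_of_isPrintedAveraged_tv` for EVERY datum of `continuumYM4_torus_of_BetaPertH`'s class and every cutoff; §4 the
consumers' form of the domain hypothesis: `|Λ|·Dm ≤ min(τ⋆, τ⋆₂)` (`mem_domTVPrinted_of_support`) — LEVEL-FREE and VOLUME-FREE;
§5 AT NODE 00's Stage-0 datum predicate `IsDatumOfRecord₀` (files 47∕48∕50's forms in the level-free format): `HolDevBound` ∕
`LoopDefectBound` on `domTVPrinted`, the NEAR-SUPPORT cone bound with NO domain hypothesis on the configuration — only the near part's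
total variation `|Λ_near|·Dm ≤ min(τ⋆, τ⋆₂)` (file 41's `loopDefect_le_of_near_support` needs only the TRUNCATION in the domain) — and
NODE S's chain END TO END for any two laws read into configurations trivial off `Λ` with `|Λ|·Dm ≤ min(τ⋆, τ⋆₂)`:
`|log∫e^{t(W−1)}dν₁ − log∫e^{t(W−1)}dν₂| ≤ 2|t|·(e²∕2)·(|w|·|Λ|·Dm)²·(θ²)ⁿ`.

HONEST FRAMING.  As file 55: the format artifact `L^{−m}` and the per-level shrink are gone; the SIZE of the admissible inserts is still
generation 8's non-optimal constant (`τ⋆₂ ≈ ρ⋆₂∕e`), constant-vs-polylog of the (1.100) inserts stays row NE1′'s ∕ NODE 00's (β);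
NOT NE1a-STEP, NOT Bałaban's (52)∕(158) verbatim, nothing on densities ∕ `R` ∕ (1.100).  (QL-a) NOT IN PRINT; NE7 NOT proved; spine 0∕9;
one fixed finite T⁴ — NOT ℝ⁴, NOT infinite volume, NOT a mass gap, NOT Clay.  No classification word moves (R10).
-/

noncomputable section
open Finset
open scoped BigOperators Matrix Matrix.Norms.L2Operator

namespace Summit.QuantumFields.BalabanUV.T4Continuum.Spine.NE7

open Literature.MathematicalPhysics.QuantumFieldTheory.Balaban1983to89
open Literature.MathematicalPhysics.QuantumFieldTheory.Balaban1983to89.T4Continuum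
open Literature.MathematicalPhysics.QuantumFieldTheory.Balaban1983to89.T4AvgSensitivity
open Literature.MathematicalPhysics.QuantumFieldTheory.Balaban1983to89.T4AvgDerivBound
open Literature.MathematicalPhysics.QuantumFieldTheory.Balaban1983to89.BlockAveraging (Idx off blockAvg)
open Literature.MathematicalPhysics.QuantumFieldTheory.Balaban1983to89.BlockAveragingTwoLevel (Pt blockAvg₂)
open ExpMeanLog FederbushMean
open Literature.MathematicalPhysics.QuantumFieldTheory.Balaban1983to89.Node00 (IsDatumOfRecord₀ isPrintedAveraged_of_isDatumOfRecord₀)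
open Literature.MathematicalPhysics.QuantumFieldTheory.Balaban1983to89.B15DeterminingSets (embIter)

section SUN

variable {n : Type*} [Fintype n] [DecidableEq n] [Nonempty n]
variable {P : Params} {j : ℕ}

/-! ## §1 The two-level radius and the framed two-level step at the configuration's own size -/

/-- THE TWO-LEVEL TOTAL-VARIATION RADIUS `τ⋆₂ = min(ρ⋆₂∕e, θ(1−θ)∕(eK₂))`. [folklore] -/
def tauStar₂ (P : Params) (n : Type*) [Fintype n] : ℝ :=
  min (radStar₂ P n / Real.exp 1) (theta P * (1 - theta P) / (Real.exp 1 * K2 P))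

/-- THE LEVEL-FREE TWO-LEVEL DOMAIN FAMILY: `tv(1, V) ≤ τ⋆₂` at every level. [folklore] -/
def domTV₂ (P : Params) (n : Type*) [Fintype n] [DecidableEq n] [Nonempty n] (j : ℕ) :
    Set (GaugeField P j (Matrix.specialUnitaryGroup n ℂ)) :=
  {V | tv 1 V ≤ tauStar₂ P n}

/-- `0 ≤ τ⋆₂`. [folklore] -/
theorem tauStar₂_nonneg (P : Params) (n : Type*) [Fintype n] [Nonempty n] : 0 ≤ tauStar₂ P n := by
  have := radStar₂_pos P n; have := theta_pos P; have := theta_le_one P; have := K2_pos P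
  have := Real.exp_pos (1 : ℝ)
  unfold tauStar₂
  refine le_min (by positivity) (div_nonneg (mul_nonneg (by positivity) (by linarith)) (by positivity))

/-- `e·τ⋆₂ ≤ ρ⋆₂` and `e·K₂·τ⋆₂ ≤ θ(1−θ)`. [folklore] -/
theorem tauStar₂_le (P : Params) (n : Type*) [Fintype n] [Nonempty n] :
    Real.exp 1 * tauStar₂ P n ≤ radStar₂ P n ∧ Real.exp 1 * K2 P * tauStar₂ P n ≤ theta P * (1 - theta P) := by
  have hK := K2_pos P
  have he := Real.exp_pos (1 : ℝ)
  have h1 := min_le_left (radStar₂ P n / Real.exp 1) (theta P * (1 - theta P) / (Real.exp 1 * K2 P))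
  have h2 := min_le_right (radStar₂ P n / Real.exp 1) (theta P * (1 - theta P) / (Real.exp 1 * K2 P))
  constructor
  · calc Real.exp 1 * tauStar₂ P n ≤ Real.exp 1 * (radStar₂ P n / Real.exp 1) := mul_le_mul_of_nonneg_left h1 he.le
      _ = radStar₂ P n := by field_simp
  · calc Real.exp 1 * K2 P * tauStar₂ P n ≤ Real.exp 1 * K2 P * (theta P * (1 - theta P) / (Real.exp 1 * K2 P)) :=
          mul_le_mul_of_nonneg_left h2 (by positivity)
      _ = theta P * (1 - theta P) := by field_simp

/-- The two-level guards at any size `s ≤ ρ⋆₂`: `2ℓs < δ_Fed`, `12|S_d|ℓs < δ_N`, `12|S_d|ℓs ≤ ½` (generation 8's `guards₂` at the top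
radius). [folklore] -/
theorem guards₂_of_le_radStar₂ (P : Params) (n : Type*) [Fintype n] [Nonempty n] {s : ℝ} (hs : s ≤ radStar₂ P n) :
    2 * (ell P * s) < deltaFed n ∧ 12 * Dn P * (ell P * s) < deltaSU n ∧ 12 * Dn P * (ell P * s) ≤ 1 / 2 := by
  have hℓ := ell_pos P; have hD := one_le_Dn P
  have h1 : 0 < deltaFed n := deltaFed_pos
  have h2 : 0 < deltaSU n := deltaSU_pos
  have h3 : deltaSU n ≤ 1 / 3 := min_le_left _ _
  have ha : s ≤ deltaFed n / (4 * ell P) := hs.trans ((min_le_left _ _).trans (min_le_left _ _))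
  have hb : s ≤ deltaSU n / (48 * Dn P * ell P) := hs.trans ((min_le_left _ _).trans (min_le_right _ _))
  have ha' : ell P * s ≤ deltaFed n / 4 := by
    calc ell P * s ≤ ell P * (deltaFed n / (4 * ell P)) := mul_le_mul_of_nonneg_left ha hℓ.le
      _ = deltaFed n / 4 := by field_simp
  have hb' : 12 * Dn P * (ell P * s) ≤ deltaSU n / 4 := by
    calc 12 * Dn P * (ell P * s) ≤ 12 * Dn P * (ell P * (deltaSU n / (48 * Dn P * ell P))) := by gcongr
      _ = deltaSU n / 4 := by field_simp; ring
  exact ⟨by linarith, by linarith, by linarith⟩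

/-- **THE FRAMED TWO-LEVEL STEP AT THE CONFIGURATION's OWN SIZE**: if `tv(1,V) ≤ e·τ⋆₂` then
`tv(1, F₂(V)) ≤ (θ + K₂·tv(1,V))·tv(1,V)` — generation 8's `tv_framed₂_le` with the sup-bound `ρ := tv(1,V)`. [folklore] -/
theorem tv_framed₂_le_self (hj : j + 1 ≤ P.m + P.K) (V : GaugeField P j (Matrix.specialUnitaryGroup n ℂ))
    (hV : tv 1 V ≤ Real.exp 1 * tauStar₂ P n) : tv 1 (framed₂ V) ≤ (theta P + K2 P * tv 1 V) * tv 1 V := by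
  obtain ⟨hF, hδ, h2⟩ := guards₂_of_le_radStar₂ P n (hV.trans (tauStar₂_le P n).1)
  exact tv_framed₂_le hj V (tv_nonneg 1 V) (dist1_le_tv_one V) hF hδ h2

/-- The two-level step as a step hypothesis for file 55's generic descent (frame `frameTransf₂`). [folklore] -/
theorem tvStep_blockAvg₂SU (j : ℕ) (hj : j + 1 ≤ P.m + P.K) (W : GaugeField P j (Matrix.specialUnitaryGroup n ℂ))
    (hW : tv 1 W ≤ Real.exp 1 * tauStar₂ P n) :
    ∃ u : GaugeTransf P (j + 1) (Matrix.specialUnitaryGroup n ℂ),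
      tv 1 (GaugeField.gaugeAct u (((fun j => (blockAvg₂ (federbushSU (n := n)) (expMeanLogSU (n := n)) :
        Averaging P j (Matrix.specialUnitaryGroup n ℂ))) j).avg W)) ≤ (theta P + K2 P * tv 1 W) * tv 1 W :=
  ⟨frameTransf₂ W, by
    show tv 1 (framed₂ W) ≤ (theta P + K2 P * tv 1 W) * tv 1 W
    exact tv_framed₂_le_self hj W hW⟩

/-- The two-level budget: `Σ_{i<n'} K₂·(e·θ^i·τ)∕θ ≤ 1` for `0 ≤ τ ≤ τ⋆₂`. [folklore] -/
theorem budget₂_le_one (P : Params) (n : Type*) [Fintype n] [Nonempty n] {τ : ℝ} (hτ0 : 0 ≤ τ) (hτ : τ ≤ tauStar₂ P n) (n' : ℕ) :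
    ∑ i ∈ range n', K2 P * (Real.exp 1 * theta P ^ i * τ) / theta P ≤ 1 := by
  have hθ0 := theta_pos P
  have hθ1 := theta_le_one P
  have hK := K2_pos P
  have he := Real.exp_pos (1 : ℝ)
  obtain ⟨_, h3⟩ := tauStar₂_le P n
  have h3' : Real.exp 1 * K2 P * τ ≤ theta P * (1 - theta P) :=
    (mul_le_mul_of_nonneg_left hτ (by positivity)).trans h3
  have hre : ∑ i ∈ range n', K2 P * (Real.exp 1 * theta P ^ i * τ) / theta P
      = Real.exp 1 * K2 P * τ / theta P * ∑ i ∈ range n', theta P ^ i := by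
    rw [Finset.mul_sum]
    exact Finset.sum_congr rfl fun i _ => by ring
  rw [hre]
  have hsum0 : 0 ≤ ∑ i ∈ range n', theta P ^ i := Finset.sum_nonneg fun i _ => pow_nonneg hθ0.le i
  rcases eq_or_lt_of_le hθ1 with h1 | h1
  · have hτz : Real.exp 1 * K2 P * τ ≤ 0 := by rw [h1] at h3'; simpa using h3'
    have hτ0' : τ = 0 := le_antisymm (by nlinarith [mul_pos he hK]) hτ0
    simp [hτ0']
  · have h1θ : 0 < 1 - theta P := by linarith
    have hS : (1 - theta P) * ∑ i ∈ range n', theta P ^ i ≤ 1 := by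
      rw [mul_neg_geom_sum]; linarith [pow_nonneg hθ0.le n']
    have hSle : ∑ i ∈ range n', theta P ^ i ≤ 1 / (1 - theta P) := by
      rw [le_div_iff₀ h1θ, mul_comm]; exact hS
    have hcoef : Real.exp 1 * K2 P * τ / theta P ≤ 1 - theta P := by
      rw [div_le_iff₀ hθ0]; linarith
    calc Real.exp 1 * K2 P * τ / theta P * ∑ i ∈ range n', theta P ^ i
        ≤ (1 - theta P) * (1 / (1 - theta P)) := mul_le_mul hcoef hSle hsum0 h1θ.le
      _ = 1 := mul_one_div_cancel h1θ.ne'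

/-! ## §2 Decay of the sizes and the shapes for the two-level prescription on `domTV₂` -/

/-- **GEOMETRIC DECAY OF THE SIZES FOR (0.10)–(0.12)**: `tv(1, (avgⁿ V)^u) ≤ e·θⁿ·tv(1, V)` for a suitable frame, whenever
`tv(1, V) ≤ τ⋆₂` (file 55's `tvDescent_of_step` at `tvStep_blockAvg₂SU`). [folklore] -/
theorem exists_frame_tv_le₂ {k n' : ℕ} (hn : k + n' ≤ P.m + P.K) (V : GaugeField P k (Matrix.specialUnitaryGroup n ℂ))
    (hV : tv 1 V ≤ tauStar₂ P n) :
    ∃ u : GaugeTransf P (k + n') (Matrix.specialUnitaryGroup n ℂ),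
      tv 1 (GaugeField.gaugeAct u (iterFrom (fun j => (blockAvg₂ (federbushSU (n := n)) (expMeanLogSU (n := n)) :
          Averaging P j (Matrix.specialUnitaryGroup n ℂ))) k n' V)) ≤ Real.exp 1 * theta P ^ n' * tv 1 V := by
  have hθ0 := theta_pos P
  have hb : ∀ m' : ℕ, ∑ i ∈ range m', K2 P * (Real.exp 1 * theta P ^ i * tv 1 V) / theta P ≤ 1 :=
    fun m' => budget₂_le_one P n (tv_nonneg 1 V) hV m'
  obtain ⟨u, hu⟩ := tvDescent_of_step hθ0 (theta_le_one P) (K2_pos P).le (tauStar₂_nonneg P n)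
    (fun j hj W hW => tvStep_blockAvg₂SU j hj W hW) V hV hb n' hn
  refine ⟨u, hu.trans (mul_le_mul_of_nonneg_right ?_ (tv_nonneg 1 V))⟩
  refine (prod_add_le_pow_mul_exp hθ0 (fun i => K2 P * (Real.exp 1 * theta P ^ i * tv 1 V)) (fun i => ?_) n').trans ?_
  · have := K2_pos P; have := tv_nonneg 1 V; have := Real.exp_pos (1:ℝ); positivity
  · rw [mul_comm]
    exact mul_le_mul_of_nonneg_right (Real.exp_le_exp.mpr (hb n')) (pow_nonneg hθ0.le _)

/-- The trivial configuration is in every two-level tv-ball. [folklore] -/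
theorem one_mem_domTV₂ (j : ℕ) : (1 : GaugeField P j (Matrix.specialUnitaryGroup n ℂ)) ∈ domTV₂ P n j := by
  show tv (1 : GaugeField P j (Matrix.specialUnitaryGroup n ℂ)) 1 ≤ tauStar₂ P n
  rw [tv_one_eq]
  simp only [show ∀ b, (1 : GaugeField P j (Matrix.specialUnitaryGroup n ℂ)) b = 1 from fun _ => rfl, GaugeGroup.dist1_one,
    Finset.sum_const_zero]
  exact tauStar₂_nonneg P n

/-- **`BondDevBound (blockAvg₂ federbushSU expMeanLogSU) domTV₂ e θ`** — two-level prescription, level-free tv-balls. [folklore] -/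
theorem bondDevBound_blockAvg₂SU_tv :
    BondDevBound (fun j => (blockAvg₂ (federbushSU (n := n)) (expMeanLogSU (n := n)) :
      Averaging P j (Matrix.specialUnitaryGroup n ℂ))) (domTV₂ P n) (Real.exp 1) (theta P) := by
  intro k n' hn V hV _
  obtain ⟨u, htv⟩ := exists_frame_tv_le₂ hn V hV
  refine ⟨u, fun c => (bdist_le_tv 1 _ c).trans ?_⟩
  calc tv 1 (GaugeField.gaugeAct u (iterFrom (fun j => (blockAvg₂ (federbushSU (n := n)) (expMeanLogSU (n := n)) :
          Averaging P j (Matrix.specialUnitaryGroup n ℂ))) k n' V)) ≤ Real.exp 1 * theta P ^ n' * tv 1 V := htv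
    _ = Real.exp 1 * (tv 1 V * theta P ^ n') := by ring

/-- **`HolDevBound (blockAvg₂ federbushSU expMeanLogSU) domTV₂ e θ`**. [folklore] -/
theorem holDevBound_blockAvg₂SU_tv :
    HolDevBound (fun j => (blockAvg₂ (federbushSU (n := n)) (expMeanLogSU (n := n)) :
      Averaging P j (Matrix.specialUnitaryGroup n ℂ))) (domTV₂ P n) (Real.exp 1) (theta P) :=
  holDevBound_of_bondDevBound bondDevBound_blockAvg₂SU_tv

/-- **`LoopDefectBound (blockAvg₂ federbushSU expMeanLogSU) domTV₂ (e²/2) θ`** (criticality on `SU(N)`). [folklore] -/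
theorem loopDefectBound_blockAvg₂SU_tv :
    LoopDefectBound (fun j => (blockAvg₂ (federbushSU (n := n)) (expMeanLogSU (n := n)) :
      Averaging P j (Matrix.specialUnitaryGroup n ℂ))) (domTV₂ P n) (1 / 2 * Real.exp 1 ^ 2) (theta P) :=
  loopDefectBound_of_holDevBound reTrCrit_specialUnitaryGroup (by norm_num) holDevBound_blockAvg₂SU_tv

/-- THE COMMON LEVEL-FREE FAMILY for the two printed prescriptions: `domTV ∩ domTV₂` — the tv-ball of radius `min(τ⋆, τ⋆₂)` at every
level. [folklore] -/
def domTVPrinted (P : Params) (n : Type*) [Fintype n] [DecidableEq n] [Nonempty n] (j : ℕ) :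
    Set (GaugeField P j (Matrix.specialUnitaryGroup n ℂ)) :=
  domTV P n j ∩ domTV₂ P n j

/-- The trivial configuration is in every common tv-ball. [folklore] -/
theorem one_mem_domTVPrinted (j : ℕ) : (1 : GaugeField P j (Matrix.specialUnitaryGroup n ℂ)) ∈ domTVPrinted P n j :=
  ⟨one_mem_domTV j, one_mem_domTV₂ j⟩

/-- **THE CONSUMERS' FORM OF THE DOMAIN HYPOTHESIS (both prescriptions)**: a configuration trivial off a finite bond set `Λ` with one-bond
deviations `≤ Dm` lies in `domTVPrinted` as soon as `|Λ|·Dm ≤ min(τ⋆, τ⋆₂)` — level-free, volume-free. [folklore] -/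
theorem mem_domTVPrinted_of_support {V : GaugeField P j (Matrix.specialUnitaryGroup n ℂ)} (Λ : Finset (PBond P j)) {Dm : ℝ}
    (hoff : ∀ b, b ∉ Λ → V b = 1) (hDm : ∀ b ∈ Λ, dist1 (V b) ≤ Dm)
    (hΛ : (Λ.card : ℝ) * Dm ≤ min (tauStar P n) (tauStar₂ P n)) : V ∈ domTVPrinted P n j := by
  refine ⟨mem_domTV_of_support Λ hoff hDm (hΛ.trans (min_le_left _ _)), ?_⟩
  -- the two-level half: the same computation with `τ⋆₂`
  have htv : tv 1 V ≤ (Λ.card : ℝ) * Dm := by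
    classical
    rw [tv_one_eq]
    have hsplit : ∑ b : PBond P j, dist1 (V b) = ∑ b ∈ Λ, dist1 (V b) := by
      refine (Finset.sum_subset (Finset.subset_univ Λ) fun b _ hb => ?_).symm
      rw [hoff b hb, GaugeGroup.dist1_one]
    rw [hsplit]
    calc ∑ b ∈ Λ, dist1 (V b) ≤ ∑ _b ∈ Λ, Dm := Finset.sum_le_sum fun b hb => hDm b hb
      _ = (Λ.card : ℝ) * Dm := by rw [Finset.sum_const, nsmul_eq_mul]
  show tv 1 V ≤ tauStar₂ P n
  exact htv.trans (hΛ.trans (min_le_right _ _))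

end SUN

/-! ## §3 The headline's printed class — two-level and both disjuncts — on the level-free family -/

section Headline

open Literature.MathematicalPhysics.QuantumFieldTheory.Balaban1983to89.T4Continuum.FiniteEpsData

variable {F : T4Family} {N : ℕ} [NeZero N]

/-- **TWO-LEVEL CLASS** (`D.IsPrintedAveraged₂`): `HolDevBound` for the datum's own averaging maps on the level-free `domTV₂`. [folklore] -/
theorem holDevBound_of_isPrintedAveraged₂_tv (D : FiniteEpsData F (Matrix.specialUnitaryGroup (Fin N) ℂ))
    (hD : D.IsPrintedAveraged₂) (K : ℕ) :
    HolDevBound (D.av K) (domTV₂ (F.P K) (Fin N)) (Real.exp 1) (theta (F.P K)) := by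
  have h : D.av K = fun j => blockAvg₂ (federbushSU (n := Fin N)) (expMeanLogSU (n := Fin N)) := funext fun j => hD K j
  rw [h]
  exact holDevBound_blockAvg₂SU_tv

/-- **NODE S's HOLONOMY-LEVEL INPUT FOR THE HEADLINE'S CLASS, BOTH DISJUNCTS, ON THE LEVEL-FREE TV-BALLS**: for every finite-`ε` datum
`D` over `SU(N)` with `D.IsPrintedAveraged` — the exact hypothesis `hD` of `T4ContinuumYM4Torus.continuumYM4_torus_of_BetaPertH` — and
every cutoff `K`, `HolDevBound (D.av K) domTVPrinted e θ`, `θ = L^{1−d}`, on the tv-balls of radius `min(τ⋆, τ⋆₂)` — the SAME radius at every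
level, no dependence on the torus exponent `m`. [folklore] -/
theorem holDevBound_of_isPrintedAveraged_tv (D : FiniteEpsData F (Matrix.specialUnitaryGroup (Fin N) ℂ))
    (hD : D.IsPrintedAveraged) (K : ℕ) :
    HolDevBound (D.av K) (domTVPrinted (F.P K) (Fin N)) (Real.exp 1) (theta (F.P K)) := by
  rcases hD with h1 | h2
  · exact (holDevBound_of_isPrintedAveraged₁_tv D h1 K).anti fun j => Set.inter_subset_left
  · exact (holDevBound_of_isPrintedAveraged₂_tv D h2 K).anti fun j => Set.inter_subset_right

/-- … and `LoopDefectBound` (constant `e²/2`) for the datum's own averaging maps, whole printed class, level-free tv-balls. [folklore] -/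
theorem loopDefectBound_of_isPrintedAveraged_tv (D : FiniteEpsData F (Matrix.specialUnitaryGroup (Fin N) ℂ))
    (hD : D.IsPrintedAveraged) (K : ℕ) :
    LoopDefectBound (D.av K) (domTVPrinted (F.P K) (Fin N)) (1 / 2 * Real.exp 1 ^ 2) (theta (F.P K)) :=
  loopDefectBound_of_holDevBound reTrCrit_specialUnitaryGroup (by norm_num) (holDevBound_of_isPrintedAveraged_tv D hD K)

/-! ## §5 At NODE 00's Stage-0 datum predicate: the shapes, the near-support cone bound and the chain END, level-free -/

/-- `HolDevBound` on `domTVPrinted` at every datum of record (`IsDatumOfRecord₀ F N D`) and every cutoff. [bookkeeping] -/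
theorem holDevBound_domTVPrinted_of_isDatumOfRecord₀ (D : FiniteEpsData F (Matrix.specialUnitaryGroup (Fin N) ℂ))
    (hD : IsDatumOfRecord₀ F N D) (K : ℕ) :
    HolDevBound (D.av K) (domTVPrinted (F.P K) (Fin N)) (Real.exp 1) (theta (F.P K)) :=
  holDevBound_of_isPrintedAveraged_tv D (isPrintedAveraged_of_isDatumOfRecord₀ F N D hD) K

/-- `LoopDefectBound` on `domTVPrinted` at every datum of record and every cutoff. [bookkeeping] -/
theorem loopDefectBound_domTVPrinted_of_isDatumOfRecord₀ (D : FiniteEpsData F (Matrix.specialUnitaryGroup (Fin N) ℂ))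
    (hD : IsDatumOfRecord₀ F N D) (K : ℕ) :
    LoopDefectBound (D.av K) (domTVPrinted (F.P K) (Fin N)) (1 / 2 * Real.exp 1 ^ 2) (theta (F.P K)) :=
  loopDefectBound_of_isPrintedAveraged_tv D (isPrintedAveraged_of_isDatumOfRecord₀ F N D hD) K

open Classical in
/-- **THE NEAR-SUPPORT DEFECT BOUND FOR THE HEADLINE's CLASS WITH NO DOMAIN HYPOTHESIS ON THE CONFIGURATION**: for every datum `D` with
`D.IsPrintedAveraged`, every cutoff, every closed walk `w` of `T^{(k+n)}`, EVERY configuration `V` trivial off a finite `Λ` with one-bond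
deviations `≤ Dm` on `Λ`, and the near part `Λ_near` (bonds of `Λ` within `(d+2)(L^{k+n} − L^k)` finest units of the walk) of total size
`|Λ_near|·Dm ≤ min(τ⋆, τ⋆₂)`: `1 − W(avgⁿ V) ≤ (e²∕2)·(|w|·|Λ_near|·Dm)²·(θ²)ⁿ` — file 41's cone bound needs only the TRUNCATION to
`Λ_near` in the domain, and on tv-balls that is a condition on the near part alone. [bookkeeping] -/
theorem loopDefect_le_of_near_support_tv (D : FiniteEpsData F (Matrix.specialUnitaryGroup (Fin N) ℂ))
    (hD : D.IsPrintedAveraged) (K : ℕ) {k n : ℕ} (hn : k + n ≤ (F.P K).m + (F.P K).K)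
    (x : Site (F.P K) (k + n)) (w : List (Letter (F.P K).d)) (hw : walkEnd x w = x)
    (V : GaugeField (F.P K) k (Matrix.specialUnitaryGroup (Fin N) ℂ)) (Λ ΛD : Finset (PBond (F.P K) k))
    (hΛD : ∀ b, b ∈ ΛD ↔ b ∈ Λ ∧ ∃ s ∈ walk x w,
      Site.tdist (embIter k b.src) (embIter (k + n) s.bond.src)
        ≤ ((F.P K).d + 2) * ((F.P K).L ^ (k + n) - (F.P K).L ^ k))
    (hoff : ∀ b, b ∉ Λ → V b = 1) {Dm : ℝ} (hDm : ∀ b ∈ Λ, dist1 (V b) ≤ Dm)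
    (hnear : (ΛD.card : ℝ) * Dm ≤ min (tauStar (F.P K) (Fin N)) (tauStar₂ (F.P K) (Fin N))) :
    1 - loopAt (iterFrom (D.av K) k n V) (walk x w)
      ≤ 1 / 2 * Real.exp 1 ^ 2 * ((w.length : ℝ) * ΛD.card * Dm) ^ 2 * (theta (F.P K) ^ 2) ^ n := by
  have htrunc : (fun b => if b ∈ ΛD then V b else 1) ∈ domTVPrinted (F.P K) (Fin N) k := by
    refine mem_domTVPrinted_of_support ΛD (fun b hb => by rw [if_neg hb]) (fun b hb => ?_) hnear
    rw [if_pos hb]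
    exact hDm b ((hΛD b).mp hb).1
  exact loopDefect_le_of_near_support (loopDefectBound_of_isPrintedAveraged_tv D hD K) (by positivity) (theta_pos (F.P K)).le hn
    x w hw V (one_mem_domTVPrinted (n := Fin N) k) Λ ΛD hΛD hoff hDm htrunc

open Classical in
/-- … and AT THE DATUM OF RECORD. [bookkeeping] -/
theorem loopDefect_le_of_near_support_tv_of_isDatumOfRecord₀ (D : FiniteEpsData F (Matrix.specialUnitaryGroup (Fin N) ℂ))
    (hD : IsDatumOfRecord₀ F N D) (K : ℕ) {k n : ℕ} (hn : k + n ≤ (F.P K).m + (F.P K).K)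
    (x : Site (F.P K) (k + n)) (w : List (Letter (F.P K).d)) (hw : walkEnd x w = x)
    (V : GaugeField (F.P K) k (Matrix.specialUnitaryGroup (Fin N) ℂ)) (Λ ΛD : Finset (PBond (F.P K) k))
    (hΛD : ∀ b, b ∈ ΛD ↔ b ∈ Λ ∧ ∃ s ∈ walk x w,
      Site.tdist (embIter k b.src) (embIter (k + n) s.bond.src)
        ≤ ((F.P K).d + 2) * ((F.P K).L ^ (k + n) - (F.P K).L ^ k))
    (hoff : ∀ b, b ∉ Λ → V b = 1) {Dm : ℝ} (hDm : ∀ b ∈ Λ, dist1 (V b) ≤ Dm)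
    (hnear : (ΛD.card : ℝ) * Dm ≤ min (tauStar (F.P K) (Fin N)) (tauStar₂ (F.P K) (Fin N))) :
    1 - loopAt (iterFrom (D.av K) k n V) (walk x w)
      ≤ 1 / 2 * Real.exp 1 ^ 2 * ((w.length : ℝ) * ΛD.card * Dm) ^ 2 * (theta (F.P K) ^ 2) ^ n :=
  loopDefect_le_of_near_support_tv D (isPrintedAveraged_of_isDatumOfRecord₀ F N D hD) K hn x w hw V Λ ΛD hΛD hoff hDm hnear

/-- **NODE S's CHAIN END TO END AT THE DATUM OF RECORD, LEVEL-FREE**: for every datum `D` with `IsDatumOfRecord₀ F N D`, every cutoff,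
ANY two probability laws `ν₁, ν₂` read into level-`k` configurations trivial off a finite bond set `Λ` with one-bond deviations `≤ Dm`
and total size `|Λ|·Dm ≤ min(τ⋆, τ⋆₂)` (NO level- or volume-dependent condition), every closed walk `w` of `T^{(k+n)}`, every `t`:
`|log ∫e^{t(W−1)}dν₁ − log ∫e^{t(W−1)}dν₂| ≤ 2|t|·(e²∕2)·(|w|·|Λ|·Dm)²·(θ²)ⁿ`, `θ = L^{1−d}`. [bookkeeping] -/
theorem abs_log_quotient_sub_le_of_support_tv_of_isDatumOfRecord₀ (D : FiniteEpsData F (Matrix.specialUnitaryGroup (Fin N) ℂ))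
    (hD : IsDatumOfRecord₀ F N D) (K : ℕ) {Ω : Type*} [MeasurableSpace Ω] (ν₁ ν₂ : MeasureTheory.Measure Ω)
    [MeasureTheory.IsProbabilityMeasure ν₁] [MeasureTheory.IsProbabilityMeasure ν₂] {k n : ℕ} (hn : k + n ≤ (F.P K).m + (F.P K).K)
    (x : Site (F.P K) (k + n)) (w : List (T4Continuum.Letter (F.P K).d)) (hw : walkEnd x w = x)
    (cfg : Ω → GaugeField (F.P K) k (Matrix.specialUnitaryGroup (Fin N) ℂ))
    (Λ : Finset (PBond (F.P K) k)) {Dm : ℝ} (hoff : ∀ ω b, b ∉ Λ → cfg ω b = 1) (hDm : ∀ ω, ∀ b ∈ Λ, dist1 (cfg ω b) ≤ Dm)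
    (hΛ : (Λ.card : ℝ) * Dm ≤ min (tauStar (F.P K) (Fin N)) (tauStar₂ (F.P K) (Fin N)))
    (hG₁ : MeasureTheory.AEStronglyMeasurable (fun ω => loopAt (iterFrom (D.av K) k n (cfg ω)) (walk x w) - 1) ν₁)
    (hG₂ : MeasureTheory.AEStronglyMeasurable (fun ω => loopAt (iterFrom (D.av K) k n (cfg ω)) (walk x w) - 1) ν₂) (t : ℝ) :
    |Real.log (∫ ω, Real.exp (t * (loopAt (iterFrom (D.av K) k n (cfg ω)) (walk x w) - 1)) ∂ν₁)
      - Real.log (∫ ω, Real.exp (t * (loopAt (iterFrom (D.av K) k n (cfg ω)) (walk x w) - 1)) ∂ν₂)|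
      ≤ 2 * (|t| * (1 / 2 * Real.exp 1 ^ 2 * ((w.length : ℝ) * Λ.card * Dm) ^ 2 * (theta (F.P K) ^ 2) ^ n)) := by
  have hL := loopDefectBound_domTVPrinted_of_isDatumOfRecord₀ D hD K
  have key : ∀ ω, |loopAt (iterFrom (D.av K) k n (cfg ω)) (walk x w) - 1|
      ≤ 1 / 2 * Real.exp 1 ^ 2 * ((w.length : ℝ) * Λ.card * Dm) ^ 2 * (theta (F.P K) ^ 2) ^ n := fun ω => by
    have hmem : cfg ω ∈ domTVPrinted (F.P K) (Fin N) k :=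
      mem_domTVPrinted_of_support Λ (fun b hb => hoff ω b hb) (hDm ω) hΛ
    have h := loopDefect_le_of_support hL (by positivity) (theta_nonneg (F.P K)) hn x w hw (cfg ω)
      hmem (one_mem_domTVPrinted k) Λ (fun b hb => hoff ω b hb) (hDm ω)
    have h0 := loopDefect_nonneg (iterFrom (D.av K) k n (cfg ω)) (walk x w)
    rw [abs_le]
    constructor <;> linarith
  exact abs_log_integral_exp_sub_le ν₁ ν₂ hG₁ hG₂ (MeasureTheory.ae_of_all _ key) (MeasureTheory.ae_of_all _ key) t

end Headline

end Summit.QuantumFields.BalabanUV.T4Continuum.Spine.NE7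

end
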